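import Summits.NavierStokesRegularity.NavierStokesRegularity.Theses.AdaptedFrequency
import Literature.Analysis.FluidPDE.AdaptedBackwardKernel
import Summits.NavierStokesRegularity.NavierStokesRegularity.Theorems.AdaptedFrequencyAdaptedFrequencyConvergesStubLandau
import Summits.NavierStokesRegularity.NavierStokesRegularity.Theorems.AdaptedFrequencyAdaptedFrequencyConvergesStubPinchingUpper
import Summits.NavierStokesRegularity.NavierStokesRegularity.Theorems.AdaptedFrequencyAdaptedFrequencyConvergesStubPinchingLower
import Summits.NavierStokesRegularity.NavierStokesRegularity.Theorems.AdaptedFrequencyAdaptedFrequencyConvergesStubKernelCalculus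

/-!
# Line `tauberian-omega-limit` — skeleton for crux `AdaptedFrequencyConverges`
(stmt-NavierStokesRegularity-10493; lead prover-line-stmt-NavierStokesRegularity-10493-0)

Rebuilt from the registered stub signatures of planner-cruxplan-…-tauberian-omega-limit
(ledger archive ids 76736–76740; the planner's `Lines/tauberian-omega-limit.lean` never reached
the tree) and RESHAPED by the lead: every stub is stated in tree vocabulary only (no bespoke
`Setting` / `SlowlyDecreasingAt`), `stub_pinching` is split into its upper (Type-I derivative
bound) and lower (ε-regularity / persistence) halves, and `stub_kernelCalculus` asks only for
differentiability of `H` (the composition uses nothing more).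

Composition (sorry-free), with `s = −log (T − t)`, `f = log ((T−t)² H)`, `df/ds = Λ − 2`:
* `stub_kernelCalculus` — `H = adaptedEnstrophy u G` is differentiable on a left
  neighbourhood of `T` (expected route: transport-free first variation
  `H′ = 2∫(ω·Sω − ν|∇ω|²) G`, cut-off + dominated convergence, derivatives of `u` bounded on
  compact time windows by the Kato/KNSS local theory in tree);
* `stub_pinchingUpper` — `(T−t)² H ≤ C₁` near `T` (Type-I gradient bound
  `‖∇u(t)‖∞ ≲ (T−t)⁻¹`, KNSS2009 Prop 4.1 in tree, + unit mass of `G`);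
* `stub_pinchingLower` — `0 < c₀ ≤ (T−t)² H` near `T` (Gaussian lower comparability of `G` +
  Type-I compactness + persistence of singularities: the FAR-FIELD step the Disproof demands);
* `stub_slowDecrease` [hardest; the NS content] — `Λ` is slowly decreasing at `T` over FIXED
  log-time windows (triage N2): `Λ t ≤ Λ t' + ε` whenever `t ≤ t' < T`, `T − t ≤ 2 (T − t')`,
  `t` close to `T`;
* `stub_landau` — pure real analysis: `H` differentiable, `(T−t)² H` pinched between positive
  constants (so `f` is bounded: `Λ₀ = 2` is forced, Cesàro convergence of `Λ − 2` is free) and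
  `(T−t)H′/H` slowly decreasing over fixed log-windows ⇒ `(T−t)H′/H → 2`.
Then `AdaptedFrequencyConverges_of : AdaptedFrequencyConverges` with `Λ₀ := 2`.

STATUS (2026-08-16): stub_landau (p78071), stub_pinchingUpper (p78510), stub_pinchingLower (p82804),
stub_kernelCalculus (p90419) LANDED under `Theorems/AdaptedFrequencyAdaptedFrequencyConvergesStub*.lean`
(namespace `…Theorems.AdaptedFrequencyConverges.TauberianOmegaLimit`) and are discharged below by
reference; the only remaining `sorry` is `stub_slowDecrease`.
-/

noncomputable section

namespace Summit.NavierStokesRegularity.NavierStokesRegularity.Cruxes.AdaptedFrequencyConverges.Lines.TauberianOmegaLimit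

open scoped Topology
open Literature.Analysis.FluidPDE Set Filter MeasureTheory
open Summit.NavierStokesRegularity.NavierStokesRegularity.Theses.AdaptedFrequency

/-! ## Stubs (registered; prove EXACTLY these signatures, `--supports stmt-NavierStokesRegularity-10493`) -/

/-- **Kernel calculus**: near `T` the adapted enstrophy `H(t) = ∫ ‖curl u(t)‖² G(t)` is
differentiable (expected: `H′ = 2∫ ⟨ω, (∇u) ω⟩ G − 2ν ∫ |∇ω|² G`, transport-free first
variation against the adapted kernel). -/
theorem stub_kernelCalculus :
    ∀ (ν T : ℝ) (u : ℝ → EuclideanSpace ℝ (Fin 3) → EuclideanSpace ℝ (Fin 3)) (p : ℝ → EuclideanSpace ℝ (Fin 3) → ℝ) (x₀ : EuclideanSpace ℝ (Fin 3)) (t₀ : ℝ) (G : ℝ → EuclideanSpace ℝ (Fin 3) → ℝ), 0 < ν → 0 < T → IsClassicalNSSolutionOn (Ico 0 T) ν 0 u p → IsLerayHopfOn T ν 0 (u 0) u → HasRapidSpatialDecay (u 0) → IsTypeIBlowup u T → t₀ ∈ Ico 0 T → (∀ r : ℝ, 0 < r → eLpNorm (Function.uncurry u) ⊤ (volume.restrict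 (parabolicCylinder r (T, x₀))) = ⊤) → IsAdaptedBackwardKernel ν u (Ico t₀ T) T x₀ G → IsGaussianComparable G (Ico t₀ T) T x₀ → ∃ t₁ ∈ Ico t₀ T, ∀ t ∈ Ioo t₁ T, DifferentiableAt ℝ (adaptedEnstrophy u G) t :=
  Summit.NavierStokesRegularity.NavierStokesRegularity.Theorems.AdaptedFrequencyConverges.TauberianOmegaLimit.stub_kernelCalculus

/-- **Upper pinching** `(T−t)² H(t) ≤ C₁` near `T` (Type-I derivative bound + unit mass). -/
theorem stub_pinchingUpper :
    ∀ (ν T : ℝ) (u : ℝ → EuclideanSpace ℝ (Fin 3) → EuclideanSpace ℝ (Fin 3)) (p : ℝ → EuclideanSpace ℝ (Fin 3) → ℝ) (x₀ : EuclideanSpace ℝ (Fin 3)) (t₀ : ℝ) (G : ℝ → EuclideanSpace ℝ (Fin 3) → ℝ), 0 < ν → 0 < T → IsClassicalNSSolutionOn (Ico 0 T) ν 0 u p → IsLerayHopfOn T ν 0 (u 0) u → HasRapidSpatialDecay (u 0) → IsTypeIBlowup u T → t₀ ∈ Ico 0 T → (∀ r : ℝ, 0 < r → eLpNorm (Function.uncurry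 u) ⊤ (volume.restrict (parabolicCylinder r (T, x₀))) = ⊤) → IsAdaptedBackwardKernel ν u (Ico t₀ T) T x₀ G → IsGaussianComparable G (Ico t₀ T) T x₀ → ∃ t₁ ∈ Ico t₀ T, ∃ C₁ : ℝ, ∀ t ∈ Ico t₁ T, (T - t) ^ 2 * adaptedEnstrophy u G t ≤ C₁ :=
  Summit.NavierStokesRegularity.NavierStokesRegularity.Theorems.AdaptedFrequencyConverges.TauberianOmegaLimit.stub_pinchingUpper

/-- **Lower pinching** `0 < c₀ ≤ (T−t)² H(t)` near `T` (Gaussian lower comparability of `G`,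
Type-I compactness, persistence of singularities — the far-field step). -/
theorem stub_pinchingLower :
    ∀ (ν T : ℝ) (u : ℝ → EuclideanSpace ℝ (Fin 3) → EuclideanSpace ℝ (Fin 3)) (p : ℝ → EuclideanSpace ℝ (Fin 3) → ℝ) (x₀ : EuclideanSpace ℝ (Fin 3)) (t₀ : ℝ) (G : ℝ → EuclideanSpace ℝ (Fin 3) → ℝ), 0 < ν → 0 < T → IsClassicalNSSolutionOn (Ico 0 T) ν 0 u p → IsLerayHopfOn T ν 0 (u 0) u → HasRapidSpatialDecay (u 0) → IsTypeIBlowup u T → t₀ ∈ Ico 0 T → (∀ r : ℝ, 0 < r → eLpNorm (Function.uncurry u) ⊤ (volume.restrict (parabolicCylinder r (T, x₀))) = ⊤) → IsAdaptedBackwardKernel ν u (Ico t₀ T) T x₀ G → IsGaussianComparable G (Ico t₀ T) T x₀ → ∃ t₁ ∈ Ico t₀ T, ∃ c₀ : ℝ, 0 < c₀ ∧ ∀ t ∈ Ico t₁ T, c₀ ≤ (T - t) ^ 2 * adaptedEnstrophy u G t :=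
  Summit.NavierStokesRegularity.NavierStokesRegularity.Theorems.AdaptedFrequencyConverges.TauberianOmegaLimit.stub_pinchingLower

/-- **Slow decrease of the adapted frequency over fixed log-time windows** [hardest stub; the
NS content]: for every `ε > 0`, eventually `Λ t ≤ Λ t' + ε` whenever `t ≤ t' < T` and
`T − t ≤ 2 (T − t')`. -/
theorem stub_slowDecrease :
    ∀ (ν T : ℝ) (u : ℝ → EuclideanSpace ℝ (Fin 3) → EuclideanSpace ℝ (Fin 3)) (p : ℝ → EuclideanSpace ℝ (Fin 3) → ℝ) (x₀ : EuclideanSpace ℝ (Fin 3)) (t₀ : ℝ) (G : ℝ → EuclideanSpace ℝ (Fin 3) → ℝ), 0 < ν → 0 < T → IsClassicalNSSolutionOn (Ico 0 T) ν 0 u p → IsLerayHopfOn T ν 0 (u 0) u → HasRapidSpatialDecay (u 0) → IsTypeIBlowup u T → t₀ ∈ Ico 0 T → (∀ r : ℝ, 0 < r → eLpNorm (Function.uncurry u) ⊤ (volume.restrict (parabolicCylinder r (T, x₀))) = ⊤) → IsAdaptedBackwardKernel ν u (Ico t₀ T) T x₀ G → IsGaussianComparable G (Ico t₀ T) T x₀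 → ∀ ε : ℝ, 0 < ε → ∃ t₁ : ℝ, t₁ < T ∧ ∀ t t' : ℝ, t₁ ≤ t → t ≤ t' → t' < T → T - t ≤ 2 * (T - t') → adaptedFrequency u G T t ≤ adaptedFrequency u G T t' + ε := by
  sorry

/-- **Landau-type Tauberian step** (pure real analysis): `H` differentiable on `[t₁, T)`,
`(T−t)² H` pinched between positive constants, `(T−t) H′/H` slowly decreasing over fixed
log-windows at `T` ⇒ `(T−t) H′/H → 2` as `t ↑ T`. -/
theorem stub_landau :
    ∀ (T t₁ : ℝ) (H : ℝ → ℝ), t₁ < T → (∀ t ∈ Ico t₁ T, DifferentiableAt ℝ H t) → (∃ c₀ C₁ : ℝ, 0 < c₀ ∧ ∀ t ∈ Ico t₁ T, c₀ ≤ (T - t) ^ 2 * H t ∧ (T - t) ^ 2 * H t ≤ C₁) → (∀ ε : ℝ, 0 < ε → ∃ t₂ : ℝ, t₂ < T ∧ ∀ t t' : ℝ, t₂ ≤ t → t ≤ t' → t' < T → T - t ≤ 2 * (T - t') → (T - t) * deriv H t / H t ≤ (T - t') * deriv H t' / H t' + ε) → Tendsto (fun t => (T - t) * deriv H t / H t)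 (𝓝[<] T) (𝓝 2) :=
  Summit.NavierStokesRegularity.NavierStokesRegularity.Theorems.AdaptedFrequencyConverges.TauberianOmegaLimit.stub_landau

/-! ## Composition -/

/-- The line closes the crux: `Λ → 2`. -/
theorem AdaptedFrequencyConverges_of : AdaptedFrequencyConverges := by
  intro ν T hν hT u p hcl hLH hdec hTI x₀ t₀ G ht₀ hsing hK hcomp H Λ hH hΛ
  have hker : IsAdaptedBackwardKernel ν u (Ico t₀ T) T x₀ G := isAdaptedBackwardKernel_iff.2 hK
  have hcmp : IsGaussianComparable G (Ico t₀ T) T x₀ := isGaussianComparable_iff_fin_three.2 hcomp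
  -- `H` is the adapted enstrophy, `Λ` the adapted frequency
  have hH' : H = adaptedEnstrophy u G := by
    rw [hH]; funext t; rfl
  have hΛ' : Λ = adaptedFrequency u G T := by
    rw [hΛ, hH']; funext t; rfl
  refine ⟨2, ?_⟩
  rw [hΛ']
  -- differentiability near `T`
  obtain ⟨t₁, ht₁, hdiff⟩ :=
    stub_kernelCalculus ν T u p x₀ t₀ G hν hT hcl hLH hdec hTI ht₀ hsing hker hcmp
  -- pinching near `T`
  obtain ⟨t₂, ht₂, C₁, hup⟩ :=
    stub_pinchingUpper ν T u p x₀ t₀ G hν hT hcl hLH hdec hTI ht₀ hsing hker hcmp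
  obtain ⟨t₂', ht₂', c₀, hc₀, hlow⟩ :=
    stub_pinchingLower ν T u p x₀ t₀ G hν hT hcl hLH hdec hTI ht₀ hsing hker hcmp
  -- slow decrease
  have hsd := stub_slowDecrease ν T u p x₀ t₀ G hν hT hcl hLH hdec hTI ht₀ hsing hker hcmp
  -- a common window `[t₃, T)`
  set t₃ : ℝ := max (max ((t₁ + T) / 2) t₂) t₂' with ht₃
  have ht₃T : t₃ < T := max_lt (max_lt (by linarith [ht₁.2]) ht₂.2) ht₂'.2
  have ht₁₃ : t₁ < t₃ :=
    lt_of_lt_of_le (by linarith [ht₁.2]) ((le_max_left _ _).trans (le_max_left _ _))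
  have ht₂₃ : t₂ ≤ t₃ := (le_max_right _ _).trans (le_max_left _ _)
  have ht₂₃' : t₂' ≤ t₃ := le_max_right _ _
  have hd : ∀ t ∈ Ico t₃ T, DifferentiableAt ℝ (adaptedEnstrophy u G) t := fun t ht =>
    hdiff t ⟨lt_of_lt_of_le ht₁₃ ht.1, ht.2⟩
  have hp : ∃ c₀ C₁ : ℝ, 0 < c₀ ∧ ∀ t ∈ Ico t₃ T,
      c₀ ≤ (T - t) ^ 2 * adaptedEnstrophy u G t ∧ (T - t) ^ 2 * adaptedEnstrophy u G t ≤ C₁ :=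
    ⟨c₀, C₁, hc₀, fun t ht =>
      ⟨hlow t ⟨ht₂₃'.trans ht.1, ht.2⟩, hup t ⟨ht₂₃.trans ht.1, ht.2⟩⟩⟩
  have hsd' : ∀ ε : ℝ, 0 < ε → ∃ t₂ : ℝ, t₂ < T ∧ ∀ t t' : ℝ, t₂ ≤ t → t ≤ t' → t' < T →
      T - t ≤ 2 * (T - t') →
        (T - t) * deriv (adaptedEnstrophy u G) t / adaptedEnstrophy u G t ≤
          (T - t') * deriv (adaptedEnstrophy u G) t' / adaptedEnstrophy u G t' + ε := by
    intro ε hε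
    obtain ⟨t₄, ht₄, h⟩ := hsd ε hε
    exact ⟨t₄, ht₄, fun t t' h1 h2 h3 h4 => by
      simpa only [adaptedFrequency_apply] using h t t' h1 h2 h3 h4⟩
  have hmain := stub_landau T t₃ (adaptedEnstrophy u G) ht₃T hd hp hsd'
  have hfun : adaptedFrequency u G T =
      fun t => (T - t) * deriv (adaptedEnstrophy u G) t / adaptedEnstrophy u G t := by
    funext t; rfl
  rw [hfun]
  exact hmain

end Summit.NavierStokesRegularity.NavierStokesRegularity.Cruxes.AdaptedFrequencyConverges.Lines.TauberianOmegaLimit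

end
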